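import Summits.HubbardSuperconductivity.HubbardSuperconductivity.Theorems.AnisotropyChordTransferFibre3TwoHoleBSChannel

/-!
# Route `AnisotropyChord` / H0 rotor rung: PROP BS, robust form — a MODEL kernel within `δ` of the torus kernel plus a margin certifies the pair (the TAIL-INEQUALITY interface of memo 21 §317(d))

Fourth file of PROP BS (memo ROTOR-THEORY-21 §314(a), §317, §320–§321, §328; theory seat `hubbard-h0-rotor-theory-1`).
`…Fibre3TwoHoleBS` reduces `TwoHoleGap L g` (HOLE₂) to a `10 × 10` certificate per pair; `…Fibre3TwoHoleBSChannel` identifies the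
exact certificate with PartN40's `twoHoleP A_L Λ̃_L ⪰ 0`.  The theory's ∀L TAIL (§317(d): `λ_min(P_L) ≥ m_ζ(Λ_L) − 1.07·K₀(ζ)·δ_L`,
with `δ_L` = the RATE-LEMMA bound on `|a_L − a_∞|` over the window, PartN39 `ShellMajorant`/`LamPartShellBound` PROVED) replaces
the torus kernel by a MODEL (the ℤ² skeleton) and pays an entrywise error.  This file proves that step abstractly:
* `pad`, `re_quad_real`, `mulVec_map_ofReal_re_im`, `abs_quad_le` (`|xᵀΔx| ≤ δ(Σ|x_p|)²` for `|Δ_pq| ≤ δ`) — bookkeeping;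
* ★ `matrixCert_of_model`: for ANY real charge map `E` and ANY real model kernel `A_m` with `|A_L − A_m| ≤ δ` entrywise, if
  `½|w|² + δ(Σ_p|(Eŵ)_p|)² ≤ 2(Eŵ)·ŵ − (Eŵ)ᵀ(Λ̃_L·11ᵀ − A_m)(Eŵ)` for every real boundary vector `w` (`ŵ` = `w` padded by zeros at
  the centres), then `MatrixCert L g z₁ z₂ E` (complex boundary data reduce to real/imaginary parts since all matrices are real);
* ★ `matrixCert_of_skeleton` / `dualCert_of_skeleton`: with `A_m = A∞` symmetric invertible, `Λ̃_L·s ≠ 1` and the Sherman–Morrison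
  charge map `E = smInv A∞ Λ̃_L`, the condition is `δ·(Σ_p|(Eŵ)_p|)² ≤ wᵀ·twoHoleP A∞ Λ̃_L·w` — the SKELETON two-hole map at the
  torus capacity (PartN40: `twoHoleP = oneHole-type Pinf + capacity lift`, `capacity_decomposition`, `TwoChannelReduction`) must
  dominate the rate-lemma error.  With `twoHoleGap_of_dualCert` this is the complete finite interface of the HOLE₂ tail: inputs =
  skeleton positivity with margin (ℚ(1/π) algebra / PartN40), `δ_L` (PartN39), capacity bounds (family A).
Prover seat `hubbard-h0-rotor-p2` g2; helper for stmt-HubbardSuperconductivity-19089 (`--supports`, helper class).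
WHAT THIS IS NOT: nothing here proves superconductivity in the Hubbard model; the rotor TARGET as originally worded stays
FALSE (g15 verdict).  Finite matrix algebra behind ONE input (HOLE₂) of ONE conditional reduction (rung 19089); it certifies no
pair by itself (the skeleton data, `δ_L` and the capacity bounds are separate inputs).  Mathlib + tree imports only; no sorry, no axioms.
-/

set_option linter.dupNamespace false

noncomputable section

open scoped BigOperators
open Complex Finset

namespace Summit.HubbardSuperconductivity.HubbardSuperconductivity.Theorems.AnisotropyChord.Transfer.Fibre3

namespace TwoHoleBS

variable (L : ℕ) [NeZero L]

/-! ## Robust form: a MODEL kernel `A_m` within `δ` of `A_L` plus a margin `δ·(ℓ¹ charge)²` certifies the pair (the §317(d) tail-inequality interface) -/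

/-- boundary vector padded by zeros at the two centre slots. [folklore] -/
def pad (w : Fin 4 ⊕ Fin 4 → ℝ) : Fin 5 ⊕ Fin 5 → ℝ :=
  Sum.elim (Fin.cons 0 fun j => w (Sum.inl j)) (Fin.cons 0 fun j => w (Sum.inr j))

omit [NeZero L] in
/-- `pad w` on the boundary embedding is `w`. [folklore] -/
theorem pad_emb (w : Fin 4 ⊕ Fin 4 → ℝ) (i : Fin 4 ⊕ Fin 4) : pad w (TwoChannel.emb i) = w i := by
  rcases i with i | i <;> rfl

omit [NeZero L] in
/-- `pad w` vanishes at the centres. [folklore] -/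
theorem pad_centre (w : Fin 4 ⊕ Fin 4 → ℝ) : pad w (Sum.inl 0) = 0 ∧ pad w (Sum.inr 0) = 0 := ⟨rfl, rfl⟩

omit [NeZero L] in
/-- a real vector vanishing at the centres is the padding of its boundary part. [folklore] -/
theorem pad_of_centre_zero {x : Fin 5 ⊕ Fin 5 → ℝ} (h1 : x (Sum.inl 0) = 0) (h2 : x (Sum.inr 0) = 0) :
    pad (fun i => x (TwoChannel.emb i)) = x := by
  funext p
  rcases p with p | p
  · refine Fin.cases ?_ (fun j => ?_) p
    · exact h1.symm
    · rfl
  · refine Fin.cases ?_ (fun j => ?_) p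
    · exact h2.symm
    · rfl

omit [NeZero L] in
/-- real part of a Hermitian-type double sum with a REAL matrix: `Re cᴴ N c = (Re c)ᵀN(Re c) + (Im c)ᵀN(Im c)`. [folklore] -/
theorem re_quad_real (N : Matrix (Fin 5 ⊕ Fin 5) (Fin 5 ⊕ Fin 5) ℝ) (c : Fin 5 ⊕ Fin 5 → ℂ) :
    (∑ p : Fin 5 ⊕ Fin 5, ∑ q : Fin 5 ⊕ Fin 5, (starRingEnd ℂ) (c p) * ((N p q : ℝ) : ℂ) * c q).re
      = dotProduct (fun p => (c p).re) (N.mulVec fun p => (c p).re)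
        + dotProduct (fun p => (c p).im) (N.mulVec fun p => (c p).im) := by
  simp only [dotProduct, Matrix.mulVec, Finset.mul_sum, ← Finset.sum_add_distrib, Complex.re_sum]
  refine Finset.sum_congr rfl fun p _ => Finset.sum_congr rfl fun q _ => ?_
  simp only [Complex.mul_re, Complex.mul_im, Complex.conj_re, Complex.conj_im, Complex.ofReal_re, Complex.ofReal_im,
    mul_zero, sub_zero]
  ring

omit [NeZero L] in
/-- `mulVec` by a real matrix commutes with taking real / imaginary parts. [folklore] -/
theorem mulVec_map_ofReal_re_im (E : Matrix (Fin 5 ⊕ Fin 5) (Fin 5 ⊕ Fin 5) ℝ) (ψ : Fin 5 ⊕ Fin 5 → ℂ) (p : Fin 5 ⊕ Fin 5) :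
    ((E.map Complex.ofReal).mulVec ψ p).re = E.mulVec (fun q => (ψ q).re) p ∧
      ((E.map Complex.ofReal).mulVec ψ p).im = E.mulVec (fun q => (ψ q).im) p := by
  constructor <;>
    simp [Matrix.mulVec, dotProduct, Matrix.map_apply, Complex.mul_re, Complex.mul_im]

omit [NeZero L] in
/-- entrywise-small perturbation against the `ℓ¹` norm: `|xᵀΔx| ≤ δ (Σ|x_p|)²`. [folklore] -/
theorem abs_quad_le (Δ : Matrix (Fin 5 ⊕ Fin 5) (Fin 5 ⊕ Fin 5) ℝ) {δ : ℝ} (hδ : ∀ p q, |Δ p q| ≤ δ)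
    (x : Fin 5 ⊕ Fin 5 → ℝ) :
    |dotProduct x (Δ.mulVec x)| ≤ δ * (∑ p : Fin 5 ⊕ Fin 5, |x p|) ^ 2 := by
  simp only [dotProduct, Matrix.mulVec, Finset.mul_sum]
  rw [sq, Finset.sum_mul_sum, Finset.mul_sum]
  refine (Finset.abs_sum_le_sum_abs _ _).trans (Finset.sum_le_sum fun p _ => ?_)
  rw [Finset.mul_sum]
  refine (Finset.abs_sum_le_sum_abs _ _).trans (Finset.sum_le_sum fun q _ => ?_)
  rw [abs_mul, abs_mul]
  have h0 : 0 ≤ δ := (abs_nonneg _).trans (hδ p q)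
  calc |x p| * (|Δ p q| * |x q|) ≤ |x p| * (δ * |x q|) := by
        gcongr
        exact hδ p q
    _ = δ * (|x p| * |x q|) := by ring

/-- ★ **ROBUST CERTIFICATE (model kernel + margin):** let `E` be any real charge map and `A_m` any real model kernel with
`|A_L − A_m| ≤ δ` entrywise (`A_L = kerMat`, e.g. `A_m` = the ℤ² skeleton and `δ = δ_L` of the RATE LEMMA).  If the real skeleton
functional `2(Eŵ)·ŵ − (Eŵ)ᵀ(Λ̃_L·11ᵀ − A_m)(Eŵ)` exceeds `½|w|² + δ(Σ_p|(Eŵ)_p|)²` for every real boundary vector `w`, then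
`MatrixCert` holds at `L` — the abstract form of the near-pair TAIL INEQUALITY (memo 21 §317(d), §321(b)). [folklore] -/
theorem matrixCert_of_model (g : ℝ) (z₁ z₂ : Tor L) (E Am : Matrix (Fin 5 ⊕ Fin 5) (Fin 5 ⊕ Fin 5) ℝ) (δ : ℝ)
    (hδ : ∀ p q, |kerMat L g z₁ z₂ p q - Am p q| ≤ δ)
    (hpos : ∀ w : Fin 4 ⊕ Fin 4 → ℝ,
      (1 / 2 : ℝ) * ∑ i : Fin 4 ⊕ Fin 4, w i ^ 2 + δ * (∑ p : Fin 5 ⊕ Fin 5, |E.mulVec (pad w) p|) ^ 2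
        ≤ 2 * dotProduct (E.mulVec (pad w)) (pad w)
          - dotProduct (E.mulVec (pad w)) ((capT L g • J10 - Am).mulVec (E.mulVec (pad w)))) :
    MatrixCert L g z₁ z₂ (E.map Complex.ofReal) := by
  intro φ h1 h2
  set ψ := restr L z₁ z₂ φ with hψ
  have hψ1 : ψ (Sum.inl 0) = 0 := by simp [hψ, restr, bsPt, clusterPt, h1]
  have hψ2 : ψ (Sum.inr 0) = 0 := by simp [hψ, restr, bsPt, clusterPt, h2]
  -- real and imaginary parts (ten slots, zero at the centres) and their boundary parts
  set ur : Fin 5 ⊕ Fin 5 → ℝ := fun p => (ψ p).re with hur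
  set ui : Fin 5 ⊕ Fin 5 → ℝ := fun p => (ψ p).im with hui
  have hpr : pad (fun i => ur (TwoChannel.emb i)) = ur := pad_of_centre_zero (by simp [hur, hψ1]) (by simp [hur, hψ2])
  have hpi : pad (fun i => ui (TwoChannel.emb i)) = ui := pad_of_centre_zero (by simp [hui, hψ1]) (by simp [hui, hψ2])
  have Hr := hpos (fun i => ur (TwoChannel.emb i))
  have Hi := hpos (fun i => ui (TwoChannel.emb i))
  rw [hpr] at Hr
  rw [hpi] at Hi
  -- the pieces of the certificate inequality in real form
  set c := (E.map Complex.ofReal).mulVec ψ with hc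
  have hcre : ∀ p, (c p).re = E.mulVec ur p := fun p => (mulVec_map_ofReal_re_im E ψ p).1
  have hcim : ∀ p, (c p).im = E.mulVec ui p := fun p => (mulVec_map_ofReal_re_im E ψ p).2
  -- (1) the norm
  have hn : ∑ p : Fin 5 ⊕ Fin 5, ‖ψ p‖ ^ 2
      = ∑ i : Fin 4 ⊕ Fin 4, ur (TwoChannel.emb i) ^ 2 + ∑ i : Fin 4 ⊕ Fin 4, ui (TwoChannel.emb i) ^ 2 := by
    have h0 := sum_eq_sum_emb (F := fun p => ((‖ψ p‖ ^ 2 : ℝ) : ℂ)) (by simp [hψ1]) (by simp [hψ2])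
    have h0' : ∑ p : Fin 5 ⊕ Fin 5, ‖ψ p‖ ^ 2 = ∑ i : Fin 4 ⊕ Fin 4, ‖ψ (TwoChannel.emb i)‖ ^ 2 := by
      exact_mod_cast h0
    rw [h0', ← Finset.sum_add_distrib]
    refine Finset.sum_congr rfl fun i _ => ?_
    rw [Complex.sq_norm, Complex.normSq_apply]
    simp only [hur, hui]
    ring
  -- (2) the linear term
  have hlin : (∑ p : Fin 5 ⊕ Fin 5, (starRingEnd ℂ) (c p) * ψ p).re
      = dotProduct (E.mulVec ur) ur + dotProduct (E.mulVec ui) ui := by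
    simp only [dotProduct, Complex.re_sum, ← Finset.sum_add_distrib]
    refine Finset.sum_congr rfl fun p _ => ?_
    rw [Complex.mul_re, Complex.conj_re, Complex.conj_im, hcre, hcim]
    simp only [hur, hui]
    ring
  -- (3) the Green term, split as model + perturbation
  have hG : ∀ p q, greenMat L g z₁ z₂ p q
      = (((capT L g • J10 - Am) p q : ℝ) : ℂ) - (((kerMat L g z₁ z₂ p q - Am p q : ℝ)) : ℂ) := by
    intro p q
    rw [greenMat_eq]
    simp only [Matrix.map_apply, Matrix.sub_apply, Matrix.smul_apply, smul_eq_mul]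
    push_cast
    ring
  have hquad : (∑ p : Fin 5 ⊕ Fin 5, ∑ q : Fin 5 ⊕ Fin 5, (starRingEnd ℂ) (c p) * greenMat L g z₁ z₂ p q * c q).re
      = (dotProduct (E.mulVec ur) ((capT L g • J10 - Am).mulVec (E.mulVec ur))
          + dotProduct (E.mulVec ui) ((capT L g • J10 - Am).mulVec (E.mulVec ui)))
        - (dotProduct (E.mulVec ur) ((kerMat L g z₁ z₂ - Am).mulVec (E.mulVec ur))
          + dotProduct (E.mulVec ui) ((kerMat L g z₁ z₂ - Am).mulVec (E.mulVec ui))) := by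
    simp_rw [hG, mul_sub, sub_mul, Finset.sum_sub_distrib, Complex.sub_re]
    rw [re_quad_real, re_quad_real]
    have e1 : (fun p => (c p).re) = E.mulVec ur := funext hcre
    have e2 : (fun p => (c p).im) = E.mulVec ui := funext hcim
    rw [e1, e2]
    rfl
  -- (4) the perturbation bound
  have hΔ : ∀ p q, |(kerMat L g z₁ z₂ - Am) p q| ≤ δ := fun p q => by rw [Matrix.sub_apply]; exact hδ p q
  have hpr' := abs_quad_le (kerMat L g z₁ z₂ - Am) hΔ (E.mulVec ur)
  have hpi' := abs_quad_le (kerMat L g z₁ z₂ - Am) hΔ (E.mulVec ui)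
  rw [hn, hlin, hquad]
  have a1 := (abs_le.mp hpr').1
  have a2 := (abs_le.mp hpi').1
  linarith [Hr, Hi, a1, a2]

/-- the boundary block of the Sherman–Morrison charge map is PartN40's `twoHoleP + ½`. [folklore] -/
theorem smInv_emb (A : Matrix (Fin 5 ⊕ Fin 5) (Fin 5 ⊕ Fin 5) ℝ) (Λ : ℝ) (i j : Fin 4 ⊕ Fin 4) :
    smInv A Λ (TwoChannel.emb i) (TwoChannel.emb j)
      = TwoChannel.twoHoleP A Λ i j + (if i = j then (1 : ℝ) / 2 else 0) := by
  simp only [smInv, TwoChannel.twoHoleP, Matrix.add_apply, Matrix.neg_apply, Matrix.smul_apply,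
    Matrix.vecMulVec_apply, Matrix.of_apply, smul_eq_mul]
  rcases i with i | i <;> rcases j with j | j <;> simp [TwoChannel.emb] <;> ring

/-- ★ **SKELETON + MARGIN ⇒ certificate:** with a symmetric invertible model kernel `A∞` (`Λ̃s ≠ 1`) within `δ` of `A_L` and the
Sherman–Morrison charge map `E = smInv A∞ Λ̃_L`, the condition reads
`δ · (Σ_p |(E ŵ)_p|)² ≤ wᵀ · twoHoleP A∞ Λ̃_L · w` for all real boundary vectors `w`:
the two-hole map of the SKELETON at the torus capacity must dominate the rate-lemma error — memo 21 §317(d) in PartN40's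
vocabulary (`twoHoleP A∞ Λ = Pinf + lift`, `capacity_decomposition`). [folklore] -/
theorem matrixCert_of_skeleton (g : ℝ) (z₁ z₂ : Tor L) (Ainf : Matrix (Fin 5 ⊕ Fin 5) (Fin 5 ⊕ Fin 5) ℝ)
    (hs : Ainf.IsSymm) (hA : IsUnit Ainf.det) (hΛ : capT L g * TwoChannel.svec2 Ainf - 1 ≠ 0) (δ : ℝ)
    (hδ : ∀ p q, |kerMat L g z₁ z₂ p q - Ainf p q| ≤ δ)
    (hpos : ∀ w : Fin 4 ⊕ Fin 4 → ℝ,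
      δ * (∑ p : Fin 5 ⊕ Fin 5, |(smInv Ainf (capT L g)).mulVec (pad w) p|) ^ 2
        ≤ dotProduct w ((TwoChannel.twoHoleP Ainf (capT L g)).mulVec w)) :
    MatrixCert L g z₁ z₂ ((smInv Ainf (capT L g)).map Complex.ofReal) := by
  apply matrixCert_of_model L g z₁ z₂ _ Ainf δ hδ
  intro w
  set Λ := capT L g with hΛdef
  set E := smInv Ainf Λ with hEdef
  have hprod := capJ_sub_mul_smInv Ainf hs hA Λ hΛ
  -- `(Λ̃J − A∞)·(E x) = x`
  have hGE : (Λ • J10 - Ainf).mulVec (E.mulVec (pad w)) = pad w := by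
    rw [Matrix.mulVec_mulVec, hprod, Matrix.one_mulVec]
  rw [hGE]
  -- `(E ŵ)·ŵ = wᵀ(P + ½)w`
  have hz : ∀ F : Fin 5 ⊕ Fin 5 → ℝ, F (Sum.inl 0) = 0 → F (Sum.inr 0) = 0 →
      ∑ p : Fin 5 ⊕ Fin 5, F p = ∑ i : Fin 4 ⊕ Fin 4, F (TwoChannel.emb i) := by
    intro F hF1 hF2
    have := sum_eq_sum_emb (F := fun p => ((F p : ℝ) : ℂ)) (by simp [hF1]) (by simp [hF2])
    exact_mod_cast this
  have hmv : ∀ i : Fin 4 ⊕ Fin 4, E.mulVec (pad w) (TwoChannel.emb i)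
      = (TwoChannel.twoHoleP Ainf Λ).mulVec w i + (1 / 2 : ℝ) * w i := by
    intro i
    simp only [Matrix.mulVec, dotProduct]
    have h := hz (fun q => E (TwoChannel.emb i) q * pad w q)
      (by simp [(pad_centre w).1]) (by simp [(pad_centre w).2])
    beta_reduce at h
    rw [h]
    simp only [pad_emb, hEdef, smInv_emb, add_mul, Finset.sum_add_distrib, ite_mul, zero_mul,
      Finset.sum_ite_eq, Finset.mem_univ, if_true]
  have hq : dotProduct (E.mulVec (pad w)) (pad w)
      = dotProduct w ((TwoChannel.twoHoleP Ainf Λ).mulVec w) + (1 / 2 : ℝ) * ∑ i : Fin 4 ⊕ Fin 4, w i ^ 2 := by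
    have h := hz (fun p => E.mulVec (pad w) p * pad w p)
      (by simp [(pad_centre w).1]) (by simp [(pad_centre w).2])
    beta_reduce at h
    unfold dotProduct
    rw [h]
    simp only [pad_emb, hmv, Finset.mul_sum, ← Finset.sum_add_distrib]
    refine Finset.sum_congr rfl fun i _ => ?_
    ring
  rw [hq]
  have := hpos w
  linarith

/-- **HOLE₂ per pair from skeleton data** (dual certificate). [folklore] -/
theorem dualCert_of_skeleton (g : ℝ) (z₁ z₂ : Tor L) (Ainf : Matrix (Fin 5 ⊕ Fin 5) (Fin 5 ⊕ Fin 5) ℝ)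
    (hs : Ainf.IsSymm) (hA : IsUnit Ainf.det) (hΛ : capT L g * TwoChannel.svec2 Ainf - 1 ≠ 0) (δ : ℝ)
    (hδ : ∀ p q, |kerMat L g z₁ z₂ p q - Ainf p q| ≤ δ)
    (hpos : ∀ w : Fin 4 ⊕ Fin 4 → ℝ,
      δ * (∑ p : Fin 5 ⊕ Fin 5, |(smInv Ainf (capT L g)).mulVec (pad w) p|) ^ 2
        ≤ dotProduct w ((TwoChannel.twoHoleP Ainf (capT L g)).mulVec w)) :
    DualCert L g z₁ z₂ :=
  dualCert_of_matrixCert L (matrixCert_of_skeleton L g z₁ z₂ Ainf hs hA hΛ δ hδ hpos)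

end TwoHoleBS

end Summit.HubbardSuperconductivity.HubbardSuperconductivity.Theorems.AnisotropyChord.Transfer.Fibre3

end
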